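import Literature.Analysis.Complex.PerronDirichletSeries
import Literature.NumberTheory.Sieve.GoldstonPintzYildirimCounting
import HarnessLib

/-!
# Goldston–Pintz–Yıldırım, *Primes in tuples I*, §6 (6.7): `T_R` as a line integral

Trunk: NumberTheory / Sieve, continuing `GoldstonPintzYildirimCounting.lean` ((6.3)–(6.5)) with the
analytic input of `Literature.Analysis.Complex.PerronHigherOrder` ((6.6)) and
`Literature.Analysis.Complex.PerronDirichletSeries` (Riesz means of a Dirichlet series).
GPY, *Primes in tuples. I* (Ann. of Math. 170 (2009) = arXiv:math/0508185), §6, p. 12, (6.7):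
for `k = |H| ≥ 1`, `R > 0`,

  `T_R(N; H) = (1/2πi) ∫_(1) F(s) R^s s^{−(k+ℓ+1)} ds`,  `F(s) = ∑_d μ(d) ν_d(H) d^{−1−s}`.

Everything here is PROVED:

* `pow_card_primeFactors_le_mul_sqrt`, `nu_le_mul_sqrt`, `summable_nu_div_sq` — the crude bound
  `ν_d(H) ≤ d_k(d) ≤ k^{k²} √d` on squarefree `d`, whence `∑ |μ(d)| ν_d(H)/d² < ∞` and `F(1+it)`
  converges absolutely;
* `integral_moebius_nu_mul_perronPow` — **(6.7)** in parametrised form,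
  `∫_{−∞}^{∞} F(1+it) R^{1+it} (1+it)^{−(k+ℓ+1)} dt = 2π T_R(N; H)` (`T_R = mainTR R H ℓ` of
  `GoldstonPintzYildirimCounting`), and `mainTR_eq_integral` — (6.7) as printed,
  `T_R = (1/2π) ∫ F(1+it) R^{1+it} (1+it)^{−(k+ℓ+1)} dt`.

The Euler product `F(s) = ∏_p (1 − ν_p(H) p^{−1−s}) = G_H(s) ζ(1+s)^{−k}` ((6.7)–(6.10)) and the
contour shift ((6.11)–(6.17)) are the next steps of the source (not here).

## References

* D. A. Goldston, J. Pintz, C. Y. Yıldırım, *Primes in tuples. I*, Ann. of Math. (2) 170 (2009),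
  819–862 = arXiv:math/0508185, §6, (6.6)–(6.7), p. 12. [cite: GoldstonPintzYildirim2009]
* H. L. Montgomery, R. C. Vaughan, *Multiplicative Number Theory I*, CUP 2007, §5.1 (5.22),
  p. 143 (Riesz typical means). [cite: MontgomeryVaughan2007]
-/

noncomputable section

open Finset Complex MeasureTheory
open scoped ArithmeticFunction.Moebius ArithmeticFunction.omega

namespace Literature.NumberTheory.Sieve.GPY

/-- For squarefree `d` and `k ≥ 1`: `d_k(d) = k^{ω(d)} ≤ k^{k²} √d` — each prime `p ≥ k²` dividing
`d` contributes `k ≤ √p`, the at most `k²` primes `p < k²` contribute `k` each. (A crude explicit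
case of `d_k(d) ≪_ε d^ε`; cf. `Literature.NumberTheory.Sieve.exists_card_divisors_le_mul_rpow` in `DivisorBound.lean` for
`τ = d_2`.) This is what makes `F(s) = ∑ μ(d)ν_d(H) d^{−1−s}` converge absolutely on `Re s = 1`
(indeed for `Re s > 1/2`). [cite: GoldstonPintzYildirim2009, Section 6 eq. 6.7] -/
theorem pow_card_primeFactors_le_mul_sqrt {k : ℕ} (hk : 1 ≤ k) {d : ℕ} (hd : Squarefree d) :
    (k : ℝ) ^ d.primeFactors.card ≤ (k : ℝ) ^ (k * k) * Real.sqrt d := by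
  have hd0 : d ≠ 0 := hd.ne_zero
  have hprod : ∏ p ∈ d.primeFactors, (p : ℝ) = d := by
    rw [← Nat.cast_prod, Nat.prod_primeFactors_of_squarefree hd]
  have hk0 : (0 : ℝ) < k := by exact_mod_cast hk
  -- split the prime factors at `k²`
  set S := d.primeFactors with hS
  set A := S.filter (fun p => p < k * k) with hA
  set B := S.filter (fun p => ¬ p < k * k) with hB
  have hcardA : A.card ≤ k * k := by
    calc A.card ≤ (Finset.range (k * k)).card := Finset.card_le_card fun p hp => by
          rw [hA, Finset.mem_filter] at hp
          exact Finset.mem_range.2 hp.2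
      _ = k * k := Finset.card_range _
  have hsqrt : Real.sqrt d = ∏ p ∈ S, Real.sqrt p := by
    rw [← hprod, Real.sqrt_eq_rpow, ← Real.finsetProd_rpow _ _ (fun p _ => Nat.cast_nonneg p)]
    exact Finset.prod_congr rfl fun p _ => (Real.sqrt_eq_rpow _).symm
  -- `k^{#S} = k^{#A} k^{#B}` and `k^{#B} ≤ ∏_{p ∈ B} √p ≤ ∏_{p ∈ S} √p`
  have hsplit : (k : ℝ) ^ S.card = (k : ℝ) ^ A.card * (k : ℝ) ^ B.card := by
    rw [← pow_add, hA, hB, Finset.card_filter_add_card_filter_not]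
  have hBle : (k : ℝ) ^ B.card ≤ ∏ p ∈ B, Real.sqrt p := by
    rw [← Finset.prod_const]
    refine Finset.prod_le_prod (fun p _ => hk0.le) fun p hp => ?_
    rw [hB, Finset.mem_filter, not_lt] at hp
    have : (k : ℝ) * k ≤ p := by exact_mod_cast hp.2
    rw [Real.le_sqrt hk0.le (Nat.cast_nonneg p)]
    nlinarith
  have hBS : ∏ p ∈ B, Real.sqrt p ≤ ∏ p ∈ S, Real.sqrt p := by
    rw [← Finset.prod_sdiff (Finset.filter_subset _ S : B ⊆ S)]
    refine le_mul_of_one_le_left (Finset.prod_nonneg fun p _ => Real.sqrt_nonneg _) ?_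
    refine Finset.one_le_prod fun p hp => ?_
    have hp2 := (Nat.prime_of_mem_primeFactors (Finset.mem_sdiff.1 hp).1).two_le
    rw [Real.le_sqrt' one_pos]
    norm_num
    exact_mod_cast le_trans (by norm_num) hp2
  have hAle : (k : ℝ) ^ A.card ≤ (k : ℝ) ^ (k * k) :=
    pow_le_pow_right₀ (by exact_mod_cast hk) hcardA
  calc (k : ℝ) ^ S.card = (k : ℝ) ^ A.card * (k : ℝ) ^ B.card := hsplit
    _ ≤ (k : ℝ) ^ (k * k) * ∏ p ∈ S, Real.sqrt p :=
        mul_le_mul hAle (hBle.trans hBS) (pow_nonneg hk0.le _) (pow_nonneg hk0.le _)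
    _ = (k : ℝ) ^ (k * k) * Real.sqrt d := by rw [hsqrt]

/-- `ν_d(H) ≤ k^{k²} √d` for squarefree `d` (`k = #H ≥ 1`), from `ν_d(H) ≤ k^{ω(d)}` (`nu_le_pow`).
[cite: GoldstonPintzYildirim2009, Section 6 eq. 6.7] -/
theorem nu_le_mul_sqrt {H : Finset ℕ} (hH : H.Nonempty) {d : ℕ} (hd : Squarefree d) :
    (nu H d : ℝ) ≤ (#H : ℝ) ^ (#H * #H) * Real.sqrt d := by
  have h1 : (nu H d : ℝ) ≤ (#H : ℝ) ^ d.primeFactors.card := by exact_mod_cast nu_le_pow H d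
  exact h1.trans (pow_card_primeFactors_le_mul_sqrt hH.card_pos hd)

/-- `∑♭_d ν_d(H)/d² < ∞` (by comparison with `∑ d^{−3/2}`): absolute convergence of `F(1 + it)`.
[cite: GoldstonPintzYildirim2009, Section 6 eq. 6.7] -/
theorem summable_nu_div_sq {H : Finset ℕ} (hH : H.Nonempty) :
    Summable fun d : ℕ => (if Squarefree d then (nu H d : ℝ) else 0) / (d : ℝ) ^ 2 := by
  have hs : Summable fun d : ℕ => (#H : ℝ) ^ (#H * #H) * ((d : ℝ) ^ (3 / 2 : ℝ))⁻¹ :=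
    (Real.summable_nat_rpow_inv.2 (by norm_num)).mul_left _
  refine Summable.of_nonneg_of_le (fun d => by positivity) (fun d => ?_) hs
  rcases Nat.eq_zero_or_pos d with rfl | hdpos
  · simp
  have hd0 : (0 : ℝ) < d := by exact_mod_cast hdpos
  split_ifs with hsq
  · rw [div_le_iff₀ (by positivity)]
    have h := nu_le_mul_sqrt hH hsq
    have e : ((d : ℝ) ^ (3 / 2 : ℝ))⁻¹ * (d : ℝ) ^ 2 = Real.sqrt d := by
      rw [Real.sqrt_eq_rpow, ← Real.rpow_neg hd0.le, ← Real.rpow_natCast (d : ℝ) 2,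
        ← Real.rpow_add hd0]
      norm_num
    calc (#H : ℝ) ^ (#H * #H) * ((d : ℝ) ^ (3 / 2 : ℝ))⁻¹ * (d : ℝ) ^ 2
        = (#H : ℝ) ^ (#H * #H) * (((d : ℝ) ^ (3 / 2 : ℝ))⁻¹ * (d : ℝ) ^ 2) := by ring
      _ = (#H : ℝ) ^ (#H * #H) * Real.sqrt d := by rw [e]
      _ ≥ nu H d := h
  · rw [zero_div]; positivity

/-- `∑_d |μ(d)| ν_d(H)/d² < ∞` — the hypothesis of
`Literature.Analysis.Complex.integral_dirichletSeries_mul_perronPow` for the coefficients `a_d = μ(d) ν_d(H)` of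
GPY's `F(s)`. [cite: GoldstonPintzYildirim2009, Section 6 eq. 6.7] -/
theorem summable_norm_moebius_mul_nu_div_sq {H : Finset ℕ} (hH : H.Nonempty) :
    Summable fun d : ℕ => ‖(μ d : ℂ) * (nu H d : ℂ)‖ / (d : ℝ) ^ 2 := by
  refine Summable.of_nonneg_of_le (fun d => by positivity) (fun d => ?_) (summable_nu_div_sq hH)
  apply div_le_div_of_nonneg_right _ (by positivity)
  rw [norm_mul, Complex.norm_intCast, Complex.norm_natCast]
  split_ifs with hsq
  · have : |((μ d : ℤ) : ℝ)| ≤ 1 := by exact_mod_cast ArithmeticFunction.abs_moebius_le_one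
    calc |((μ d : ℤ) : ℝ)| * (nu H d : ℝ) ≤ 1 * nu H d :=
          mul_le_mul_of_nonneg_right this (Nat.cast_nonneg _)
      _ = nu H d := one_mul _
  · rw [ArithmeticFunction.moebius_eq_zero_of_not_squarefree hsq]
    simp

/-- **GPY (6.7)** (parametrised form): for `k = |H| ≥ 1`, `R > 0`, `ℓ ≥ 0`,
`∫_{−∞}^{∞} F(1+it) R^{1+it} (1+it)^{−(k+ℓ+1)} dt = 2π T_R(N; H)`, where
`F(s) = ∑_d μ(d) ν_d(H) d^{−(1+s)}` and
`T_R(N; H) = (1/(k+ℓ)!) ∑_{d ≤ R} (μ(d)ν_d(H)/d) (log R/d)^{k+ℓ}` is `mainTR R H ℓ` ((6.3)); an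
instance of `Literature.Analysis.Complex.integral_dirichletSeries_mul_perronPow`.
[cite: GoldstonPintzYildirim2009, Section 6 eq. 6.7] -/
theorem integral_moebius_nu_mul_perronPow {R : ℝ} (hR : 0 < R) {H : Finset ℕ} (hH : H.Nonempty)
    (ℓ : ℕ) :
    ∫ t : ℝ, (∑' d : ℕ, (μ d : ℂ) * (nu H d : ℂ) / (d : ℂ) ^ (1 + (((1 : ℝ) : ℂ) + t * I))) *
        Literature.Analysis.Complex.perronPow R (#H + ℓ) (((1 : ℝ) : ℂ) + t * I) =
      2 * Real.pi * (mainTR R H ℓ : ℂ) := by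
  have hm : 1 ≤ #H + ℓ :=
    le_trans (Nat.one_le_iff_ne_zero.2 (Finset.card_ne_zero.2 hH)) (Nat.le_add_right _ _)
  rw [Literature.Analysis.Complex.integral_dirichletSeries_mul_perronPow (summable_norm_moebius_mul_nu_div_sq hH)
    hR hm, mainTR]
  push_cast
  congr 1
  rw [Finset.mul_sum]
  refine Finset.sum_congr rfl fun d _ => ?_
  ring

/-- **GPY (6.7)** as printed: `T_R(N; H) = (1/2πi) ∫_(1) F(s) R^s s^{−(k+ℓ+1)} ds`, i.e. with
`s = 1 + it`, `ds = i dt`: `T_R(N; H) = (1/2π) ∫_{−∞}^{∞} F(1+it) R^{1+it} (1+it)^{−(k+ℓ+1)} dt`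
(`k = |H| ≥ 1`, `R > 0`). [cite: GoldstonPintzYildirim2009, Section 6 eq. 6.7] -/
theorem mainTR_eq_integral {R : ℝ} (hR : 0 < R) {H : Finset ℕ} (hH : H.Nonempty) (ℓ : ℕ) :
    (mainTR R H ℓ : ℂ) = (1 / (2 * Real.pi) : ℂ) *
      ∫ t : ℝ, (∑' d : ℕ, (μ d : ℂ) * (nu H d : ℂ) / (d : ℂ) ^ (1 + (((1 : ℝ) : ℂ) + t * I))) *
        Literature.Analysis.Complex.perronPow R (#H + ℓ) (((1 : ℝ) : ℂ) + t * I) := by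
  rw [integral_moebius_nu_mul_perronPow hR hH ℓ]
  have hπ : (2 * Real.pi : ℂ) ≠ 0 := by exact_mod_cast (mul_pos two_pos Real.pi_pos).ne'
  field_simp

end Literature.NumberTheory.Sieve.GPY
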